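import Literature.AlgebraicGeometry.Frobenioids.Thm42OfPreStepsGeneral
import Literature.AlgebraicGeometry.Frobenioids.Thm49Assembly
import Literature.AlgebraicGeometry.Frobenioids.Thm49Compat
import Literature.AlgebraicGeometry.Frobenioids.DivisorMonoidIsoDescentFormulas
import HarnessLib

/-!
# [FrdI] Theorem 4.9 WITH its `Ψ^Prime`-compatibility clause AT THE `C`-LEVEL, MODULO ONLY "`Ψ`, `Ψ⁻¹`
# preserve pre-steps" (Thm. 3.4 (ii)) — no hypothesis on the base categories beyond print's standard type
# (Def. 3.1 (i)(d)); corollary over the author's revised (2024) FSMFF bases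

Mochizuki, *The geometry of Frobenioids I: the general theory*, Kyushu J. Math. **62** (2008) 293–400,
§4, Theorem 4.9, statement p. 88 l. 33 – p. 89 l. 2, proof p. 89 ll. 3–41 [cite: MochizukiFrdI2008, Thm. 4.9 p.88];
*Comments* (2024) (28) p. 3 [cite: MochizukiFrdIComments2024, (28) p.3].

PROOF-ONLY file (cell abc-iut, layer L1, node `FrdI:Thm4.9`; seat abc-iut-w4-d105): the route of
`Thm49CompatOfFunctor.lean` (same seat; over bases of FSM-type) re-run with the base hypothesis replaced by the
single transport statement "`Ψ` and `Ψ⁻¹` preserve pre-steps" (Thm. 3.4 (ii), first clause): the setting of the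
proof at THE perfections `C_i^pf` from the PRINTED hypotheses (`FrdI.T42.setting_perfection_asPrinted`,
`Thm42OfPreStepsGeneral.lean`), `Ψ^pf` from `isFrobeniusCompatible_of_preservesPreSteps` (seat abc-iut-L1-t11's
Thm. 3.4 (iii) transports), Thm. 4.9 with compatibility there (`FrdI.T49.exists_thm49_compat_perfect_primarySupp`,
seat abc-iut-w4-d099 et al.), the descent of `Ψ^Φ` WITH its divisor clause (`FrdI.T49.exists_divisorMonoidIsoOver_of_perfection`,
seat abc-iut-L1-t14), THE `Ψ^Prime` of Thm. 4.2 (ii) at the `C`-level (`FrdI.T42.thm42ii_ofFunctor_of_preservesPreSteps`)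
and the compatibility "from the construction" (`FrdI.T49.thm49_compat_of_divClause`, seat abc-iut-w4-d105).

* `FrdI.T49.exists_divisorMonoidIsoOver_divClause_of_preservesPreSteps` — Thm. 4.9's `Ψ^Φ : Φ₁ ⥲ Φ₂` over `Ψ`
  ON THE `C_i` with its divisor clause on pre-steps (isotropic standard non-group-like `C_i`, `Φ_i`
  perf-factorial, `C₁` of rational type at THE constructions), modulo pre-step preservation;
* `FrdI.T49.exists_thm49_compat_ofFunctor_of_preservesPreSteps` — **Thm. 4.9 WITH its compatibility clause at
  the `C`-level** (THE `Ψ^Prime`, clauses (a)(b); `Ψ^Φ` with divisor clause; the typed `Thm49_compat`), modulo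
  pre-step preservation; `…_forall` — compatibility with EVERY prime-correspondence satisfying clause (a);
* `FrdI.T49.thm49_ofFunctor_of_preservesPreSteps_of_isotropic` — the typed `Thm49` itself for isotropic,
  non-group-like `C_i`, modulo pre-step preservation;
* `FrdI.T49.exists_thm49_compat_ofFunctor_of_isOfFSMFFType2024` — the same over bases of FSMFF-type in the
  author's revised (2024) sense (twin of `exists_thm49_compat_ofFunctor_of_isOfFSMType`, completing seat
  abc-iut-w4-d109's `Thm49AssemblyFSMFF2024.lean` by the compatibility clause).

No new definitions; no statement of the paper is strengthened; nothing here bears on [IUTchIII] Cor. 3.12.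
-/

namespace Literature.AlgebraicGeometry.Frobenioids

namespace FrdI.T49

open CategoryTheory Opposite PreFrobenioidData

universe w v v' u u'

variable {D₁ : Type u} [Category.{v} D₁] {Φ₁ : D₁ᵒᵖ ⥤ CommMonCat.{w}} {C₁ : Type u'} [Category.{v'} C₁]
  {D₂ : Type u} [Category.{v} D₂] {Φ₂ : D₂ᵒᵖ ⥤ CommMonCat.{w}} {C₂ : Type u'} [Category.{v'} C₂]
  {F₁ : C₁ ⥤ ElemFrobenioid Φ₁} {F₂ : C₂ ⥤ ElemFrobenioid Φ₂}

/-- **Thm. 4.9's `Ψ^Φ` ON THE `C_i`, WITH ITS DIVISOR CLAUSE, modulo "`Ψ`, `Ψ⁻¹` preserve pre-steps"** (proof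
p. 89 ll. 25–41): for Frobenioids `C_i → F_{Φ_i}` of standard and isotropic, non-group-like type (`Thm42Setting`)
with perf-factorial `Φ_i` (no base hypothesis beyond print's standard type), `C₁` of rational type at THE birationalization / support, and an
equivalence `Ψ : C₁ ⥲ C₂` such that `Ψ` and `Ψ⁻¹` preserve pre-steps, there is an isomorphism of functors
`Ψ^Φ : Φ₁ ⥲ Φ₂` lying over `Ψ` computing `Ψ^Φ_A(Div φ) = Div(Ψ φ)` for every pre-step `φ : A → B` of `C₁`.
[cite: MochizukiFrdI2008, Thm. 4.9 p.89] -/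
theorem exists_divisorMonoidIsoOver_divClause_of_preservesPreSteps (hF₁ : PreFrobenioid.IsFrobenioid F₁)
    (hF₂ : PreFrobenioid.IsFrobenioid F₂)
    (hpf₁ : Objectwise (fun M _ => IsPerfFactorial M) Φ₁) (hpf₂ : Objectwise (fun M _ => IsPerfFactorial M) Φ₂)
    (hrat₁ : ∀ A : C₁, PreFrobenioidData.IsRational
      (PreFrobenioid.biratData hF₁ (PreFrobenioid.hasBiratSquares_of_isFrobenioid hF₁))
      (S := ofFunctor Φ₁ F₁) (fun a 𝔭 => PrimarySupp a 𝔭) A)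
    (Ψ : C₁ ≌ C₂) (hT : Thm42Setting (ofFunctor Φ₁ F₁) (ofFunctor Φ₂ F₂))
    (hpre : ∀ ⦃X Y : C₁⦄ (φ : X ⟶ Y), PreFrobenioid.IsPreStep F₁ φ → PreFrobenioid.IsPreStep F₂ (Ψ.functor.map φ))
    (hpre' : ∀ ⦃X Y : C₂⦄ (φ : X ⟶ Y), PreFrobenioid.IsPreStep F₂ φ → PreFrobenioid.IsPreStep F₁ (Ψ.inverse.map φ)) :
    ∃ E : DivisorMonoidIsoOver (ofFunctor Φ₁ F₁) (ofFunctor Φ₂ F₂) Ψ,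
      ∀ ⦃A B : C₁⦄ (φ : A ⟶ B), PreFrobenioid.IsPreStep F₁ φ →
        E.iso A (PreFrobenioid.Div F₁ φ) = PreFrobenioid.Div F₂ (Ψ.functor.map φ) := by
  obtain ⟨hi₁, -, -, -, hN₁, hN₂⟩ := FrdI.T42.of_thm42Setting hT
  have hs₁ := hT.standard.1
  have hs₂ := hT.standard.2
  -- Thm. 3.4 (iii) from pre-step preservation: `Ψ` is compatible with arrows of Frobenius type
  have hΨ : PreFrobenioid.IsFrobeniusCompatible F₁ F₂ Ψ.functor :=
    isFrobeniusCompatible_of_preservesPreSteps hF₁ hF₂ hs₁.quasiIsotropic hs₂.quasiIsotropic hs₁.nonDilating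
      hs₂.nonDilating Ψ (fun _ _ φ h => hpre φ h) (fun _ _ φ h => hpre' φ h) hN₁ hN₂
  -- the setting of the proof at THE perfections (no base hypothesis beyond standard type)
  haveI := PreFrobenioid.Perfection.map_isEquivalence (hF₁ := hF₁) (hF₂ := hF₂) Ψ hΨ
  have S := FrdI.T42.setting_perfection_asPrinted Ψ hF₁ hF₂ hpf₁ hpf₂ hT hΨ
  -- `Φ₂^pf` non-dilating on `D₂`; `C₁^pf` of rational type (Prop. 5.5 (iii))
  have hndp₂ : IsNonDilatingOn (PreFrobenioid.Perfection.ops hF₂).monFunctor :=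
    FrdI.isNonDilatingOn_of_ofFunctor (F := (PreFrobenioid.Perfection.ops hF₂).toFunctor)
      (PreFrobenioid.Perfection.isNonDilatingOn_ops hF₂ hs₂.nonDilating)
  have hPf₁ := PreFrobenioid.Perfection.isFrobenioid hF₁ (FrdI.T42.isFrobeniusIsotropic_of_isOfIsotropicType hF₁ hi₁)
  have hratP : ∀ ⦃X : PreFrobenioid.Perfection hF₁⦄,
      PreFrobenioid.IsUniversallyDivFrobeniusTrivial (PreFrobenioid.Perfection.ops hF₁).toFunctor X →
        PreFrobenioidData.IsRational (PreFrobenioid.biratData S.isFrobenioid₁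
          (PreFrobenioid.hasBiratSquares_of_isFrobenioid S.isFrobenioid₁))
          (S := ofFunctor _ (PreFrobenioid.Perfection.ops hF₁).toFunctor) (fun a 𝔭 => PrimarySupp a 𝔭) X :=
    fun X _ => PreFrobenioid.Perfection.isRational_perfection_of hF₁ hPf₁ hrat₁ X
  -- Thm. 4.9 WITH compatibility at the perfections, then the descent keeping the divisor clause
  obtain ⟨E', -, -, hE', -⟩ := exists_thm49_compat_perfect_primarySupp S hndp₂ hratP
  obtain ⟨E, -, hE⟩ := exists_divisorMonoidIsoOver_of_perfection hF₁ hF₂ Ψ hΨ hpre' E'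
    (fun X Y f hf => hE' f hf)
  exact ⟨E, hE⟩

/-- **[FrdI] Theorem 4.9 WITH its compatibility clause, AT THE `C`-LEVEL, modulo "`Ψ`, `Ψ⁻¹` preserve
pre-steps"** (Thm. 3.4 (ii)) — the typed `PreFrobenioidData.Thm49_compat (ofFunctor Φ₁ F₁) (ofFunctor Φ₂ F₂) Ψ E e`
for Frobenioids with no base hypothesis beyond print's standard type: under `Thm42Setting`, `Φ_i` perf-factorial, `C₁` of rational type at THE
constructions, there exist THE `Ψ^Prime` of Thm. 4.2 (ii) (clauses (a), (b); unique by the typed `Thm42ii`,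
`FrdI.T42.thm42ii_ofFunctor_of_preservesPreSteps`) and a `Ψ^Φ : Φ₁ ⥲ Φ₂` over `Ψ` with the divisor clause on
pre-steps, satisfying the typed `Thm49_compat`. [cite: MochizukiFrdI2008, Thm. 4.9 p.88] -/
theorem exists_thm49_compat_ofFunctor_of_preservesPreSteps (hF₁ : PreFrobenioid.IsFrobenioid F₁)
    (hF₂ : PreFrobenioid.IsFrobenioid F₂)
    (hpf₁ : Objectwise (fun M _ => IsPerfFactorial M) Φ₁) (hpf₂ : Objectwise (fun M _ => IsPerfFactorial M) Φ₂)
    (hrat₁ : ∀ A : C₁, PreFrobenioidData.IsRational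
      (PreFrobenioid.biratData hF₁ (PreFrobenioid.hasBiratSquares_of_isFrobenioid hF₁))
      (S := ofFunctor Φ₁ F₁) (fun a 𝔭 => PrimarySupp a 𝔭) A)
    (Ψ : C₁ ≌ C₂) (hT : Thm42Setting (ofFunctor Φ₁ F₁) (ofFunctor Φ₂ F₂))
    (hpre : ∀ ⦃X Y : C₁⦄ (φ : X ⟶ Y), PreFrobenioid.IsPreStep F₁ φ → PreFrobenioid.IsPreStep F₂ (Ψ.functor.map φ))
    (hpre' : ∀ ⦃X Y : C₂⦄ (φ : X ⟶ Y), PreFrobenioid.IsPreStep F₂ φ → PreFrobenioid.IsPreStep F₁ (Ψ.inverse.map φ)) :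
    ∃ (E : DivisorMonoidIsoOver (ofFunctor Φ₁ F₁) (ofFunctor Φ₂ F₂) Ψ)
      (e : ∀ A : C₁, Primes (Φ₁.obj (op (PreFrobenioid.baseObj F₁ A))) ≃
        Primes (Φ₂.obj (op (PreFrobenioid.baseObj F₂ (Ψ.functor.obj A))))),
      (∀ (A : C₁) (𝔭 : Primes (Φ₁.obj (op (PreFrobenioid.baseObj F₁ A)))),
        (∀ ⦃B : C₁⦄ (φ : A ⟶ B), PreFrobenioid.IsCoAngularPreStep F₁ φ →
            (PreFrobenioid.Div F₁ φ ∈ 𝔭.submonoid ↔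
              PreFrobenioid.Div F₂ (Ψ.functor.map φ) ∈ (e A 𝔭).submonoid)) ∧
        ∀ ⦃B : C₁⦄ (ψ : B ⟶ A), PreFrobenioid.IsCoAngularPreStep F₁ ψ →
          ((∃ y ∈ 𝔭.submonoid, pull Φ₁ (PreFrobenioid.Base F₁ ψ) y = PreFrobenioid.Div F₁ ψ) ↔
            ∃ y ∈ (e A 𝔭).submonoid, pull Φ₂ (PreFrobenioid.Base F₂ (Ψ.functor.map ψ)) y =
              PreFrobenioid.Div F₂ (Ψ.functor.map ψ))) ∧
      (∀ ⦃A B : C₁⦄ (φ : A ⟶ B), PreFrobenioid.IsPreStep F₁ φ →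
          E.iso A (PreFrobenioid.Div F₁ φ) = PreFrobenioid.Div F₂ (Ψ.functor.map φ)) ∧
      Literature.AlgebraicGeometry.Frobenioids.PreFrobenioidData.Thm49_compat
        (ofFunctor Φ₁ F₁) (ofFunctor Φ₂ F₂) Ψ E e := by
  -- THE `Ψ^Prime` of Thm. 4.2 (ii) at the `C`-level, modulo pre-step preservation
  obtain ⟨e, he, -⟩ := FrdI.T42.thm42ii_ofFunctor_of_preservesPreSteps Ψ hF₁ hF₂ hpf₁ hpf₂ hpre hpre' hT
  have he' : ∀ (A : C₁) (𝔭 : Primes (Φ₁.obj (op (PreFrobenioid.baseObj F₁ A)))),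
      (∀ ⦃B : C₁⦄ (φ : A ⟶ B), PreFrobenioid.IsCoAngularPreStep F₁ φ →
          (PreFrobenioid.Div F₁ φ ∈ 𝔭.submonoid ↔
            PreFrobenioid.Div F₂ (Ψ.functor.map φ) ∈ (e A 𝔭).submonoid)) ∧
        ∀ ⦃B : C₁⦄ (ψ : B ⟶ A), PreFrobenioid.IsCoAngularPreStep F₁ ψ →
          ((∃ y ∈ 𝔭.submonoid, pull Φ₁ (PreFrobenioid.Base F₁ ψ) y = PreFrobenioid.Div F₁ ψ) ↔
            ∃ y ∈ (e A 𝔭).submonoid, pull Φ₂ (PreFrobenioid.Base F₂ (Ψ.functor.map ψ)) y =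
              PreFrobenioid.Div F₂ (Ψ.functor.map ψ)) := fun A 𝔭 =>
    ⟨fun B φ hφ => (he A 𝔭).1 φ ((ofFunctor_isCoAngularPreStep F₁ φ).mpr hφ),
      fun B ψ hψ => (he A 𝔭).2 ψ ((ofFunctor_isCoAngularPreStep F₁ ψ).mpr hψ)⟩
  obtain ⟨E, hE⟩ := exists_divisorMonoidIsoOver_divClause_of_preservesPreSteps hF₁ hF₂ hpf₁ hpf₂ hrat₁ Ψ hT
    hpre hpre'
  exact ⟨E, e, he', hE, thm49_compat_of_divClause F₁ F₂ Ψ hF₁ E e (fun A 𝔭 => (he' A 𝔭).1)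
    fun _ _ φ hφ => hE φ hφ.2⟩

/-- **Compatibility with EVERY prime-correspondence satisfying clause (a) of Thm. 4.2 (ii), modulo "`Ψ`, `Ψ⁻¹`
preserve pre-steps"** (p. 89 ll. 1–2 with ll. 12–33 "from the construction").
[cite: MochizukiFrdI2008, Thm. 4.9 p.89] -/
theorem exists_divisorMonoidIsoOver_thm49_compat_forall_of_preservesPreSteps (hF₁ : PreFrobenioid.IsFrobenioid F₁)
    (hF₂ : PreFrobenioid.IsFrobenioid F₂)
    (hpf₁ : Objectwise (fun M _ => IsPerfFactorial M) Φ₁) (hpf₂ : Objectwise (fun M _ => IsPerfFactorial M) Φ₂)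
    (hrat₁ : ∀ A : C₁, PreFrobenioidData.IsRational
      (PreFrobenioid.biratData hF₁ (PreFrobenioid.hasBiratSquares_of_isFrobenioid hF₁))
      (S := ofFunctor Φ₁ F₁) (fun a 𝔭 => PrimarySupp a 𝔭) A)
    (Ψ : C₁ ≌ C₂) (hT : Thm42Setting (ofFunctor Φ₁ F₁) (ofFunctor Φ₂ F₂))
    (hpre : ∀ ⦃X Y : C₁⦄ (φ : X ⟶ Y), PreFrobenioid.IsPreStep F₁ φ → PreFrobenioid.IsPreStep F₂ (Ψ.functor.map φ))
    (hpre' : ∀ ⦃X Y : C₂⦄ (φ : X ⟶ Y), PreFrobenioid.IsPreStep F₂ φ → PreFrobenioid.IsPreStep F₁ (Ψ.inverse.map φ)) :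
    ∃ E : DivisorMonoidIsoOver (ofFunctor Φ₁ F₁) (ofFunctor Φ₂ F₂) Ψ,
      (∀ ⦃A B : C₁⦄ (φ : A ⟶ B), PreFrobenioid.IsPreStep F₁ φ →
          E.iso A (PreFrobenioid.Div F₁ φ) = PreFrobenioid.Div F₂ (Ψ.functor.map φ)) ∧
      ∀ (e : ∀ A : C₁, Primes (Φ₁.obj (op (PreFrobenioid.baseObj F₁ A))) ≃
          Primes (Φ₂.obj (op (PreFrobenioid.baseObj F₂ (Ψ.functor.obj A))))),
        (∀ (A : C₁) (𝔭 : Primes (Φ₁.obj (op (PreFrobenioid.baseObj F₁ A)))) ⦃B : C₁⦄ (φ : A ⟶ B),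
          PreFrobenioid.IsCoAngularPreStep F₁ φ →
            (PreFrobenioid.Div F₁ φ ∈ 𝔭.submonoid ↔
              PreFrobenioid.Div F₂ (Ψ.functor.map φ) ∈ (e A 𝔭).submonoid)) →
        Literature.AlgebraicGeometry.Frobenioids.PreFrobenioidData.Thm49_compat
          (ofFunctor Φ₁ F₁) (ofFunctor Φ₂ F₂) Ψ E e := by
  obtain ⟨E, hE⟩ := exists_divisorMonoidIsoOver_divClause_of_preservesPreSteps hF₁ hF₂ hpf₁ hpf₂ hrat₁ Ψ hT
    hpre hpre'
  exact ⟨E, hE, fun e he => thm49_compat_of_divClause F₁ F₂ Ψ hF₁ E e he fun _ _ φ hφ => hE φ hφ.2⟩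

/-! ### Theorem 4.9 itself (the typed `Thm49`) for isotropic `C_i`, modulo "`Ψ`, `Ψ⁻¹` preserve pre-steps" -/

/-- **[FrdI] Theorem 4.9 AS TYPED (`PreFrobenioidData.Thm49` at `ofFunctor`) for Frobenioids of ISOTROPIC,
non-group-like type with perf-factorial `Φ_i` and `C₁` of rational type at THE constructions, MODULO ONLY "`Ψ`,
`Ψ⁻¹` preserve pre-steps"** (Thm. 3.4 (ii)) — no base hypothesis beyond print's standard type: for `C_i` of
rationally standard type there is an isomorphism of functors `Ψ^Φ : Φ₁ ⥲ Φ₂` lying over `Ψ` (the general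
quasi-isotropic case over FSM / FSMFF-2024 bases is seat abc-iut-w4-d109's `thm49_ofFunctor_of_isOfFSMType` /
`thm49_ofFunctor_of_isOfFSMFFType2024`). [cite: MochizukiFrdI2008, Thm. 4.9 p.88] -/
theorem thm49_ofFunctor_of_preservesPreSteps_of_isotropic (hF₁ : PreFrobenioid.IsFrobenioid F₁)
    (hF₂ : PreFrobenioid.IsFrobenioid F₂)
    (hpf₁ : Objectwise (fun M _ => IsPerfFactorial M) Φ₁) (hpf₂ : Objectwise (fun M _ => IsPerfFactorial M) Φ₂)
    (hrat₁ : ∀ A : C₁, PreFrobenioidData.IsRational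
      (PreFrobenioid.biratData hF₁ (PreFrobenioid.hasBiratSquares_of_isFrobenioid hF₁))
      (S := ofFunctor Φ₁ F₁) (fun a 𝔭 => PrimarySupp a 𝔭) A)
    (Ψ : C₁ ≌ C₂) (hi : (ofFunctor Φ₁ F₁).IsOfIsotropicType ∧ (ofFunctor Φ₂ F₂).IsOfIsotropicType)
    (hng : ¬ (ofFunctor Φ₁ F₁).IsOfGroupLikeType ∧ ¬ (ofFunctor Φ₂ F₂).IsOfGroupLikeType)
    (hpre : ∀ ⦃X Y : C₁⦄ (φ : X ⟶ Y), PreFrobenioid.IsPreStep F₁ φ → PreFrobenioid.IsPreStep F₂ (Ψ.functor.map φ))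
    (hpre' : ∀ ⦃X Y : C₂⦄ (φ : X ⟶ Y), PreFrobenioid.IsPreStep F₂ φ → PreFrobenioid.IsPreStep F₁ (Ψ.inverse.map φ))
    (R₁ : (ofFunctor Φ₁ F₁).RSParams) (R₂ : (ofFunctor Φ₂ F₂).RSParams) :
    (ofFunctor Φ₁ F₁).Thm49 (ofFunctor Φ₂ F₂) Ψ R₁ R₂ := fun hR₁ hR₂ => by
  obtain ⟨E, -⟩ := exists_divisorMonoidIsoOver_divClause_of_preservesPreSteps hF₁ hF₂ hpf₁ hpf₂ hrat₁ Ψ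
    ⟨⟨hR₁.standard, hR₂.standard⟩, hi, hng⟩ hpre hpre'
  exact ⟨E⟩

/-! ### Corollary over the author's revised (2024) FSMFF bases -/

/-- **[FrdI] Theorem 4.9 WITH its compatibility clause at the `C`-level, over bases of FSMFF-type in the author's
revised (2024) sense** (Thm. 3.4 (ii) over such bases: `FrdI.isPreStep_map_of_quasiIsotropic_of_isOfFSMFFType2024`,
seat abc-iut-L1-t11) — the twin of `exists_thm49_compat_ofFunctor_of_isOfFSMType` (`Thm49CompatOfFunctor.lean`)
and the compatibility companion of seat abc-iut-w4-d109's `thm49_ofFunctor_of_isOfFSMFFType2024`.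
[cite: MochizukiFrdI2008, Thm. 4.9 p.88] [cite: MochizukiFrdIComments2024, (28) p.3] -/
theorem exists_thm49_compat_ofFunctor_of_isOfFSMFFType2024 (hF₁ : PreFrobenioid.IsFrobenioid F₁)
    (hF₂ : PreFrobenioid.IsFrobenioid F₂) (hD₁ : IsOfFSMFFType2024 D₁) (hD₂ : IsOfFSMFFType2024 D₂)
    (hpf₁ : Objectwise (fun M _ => IsPerfFactorial M) Φ₁) (hpf₂ : Objectwise (fun M _ => IsPerfFactorial M) Φ₂)
    (hrat₁ : ∀ A : C₁, PreFrobenioidData.IsRational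
      (PreFrobenioid.biratData hF₁ (PreFrobenioid.hasBiratSquares_of_isFrobenioid hF₁))
      (S := ofFunctor Φ₁ F₁) (fun a 𝔭 => PrimarySupp a 𝔭) A)
    (Ψ : C₁ ≌ C₂) (hT : Thm42Setting (ofFunctor Φ₁ F₁) (ofFunctor Φ₂ F₂)) :
    ∃ (E : DivisorMonoidIsoOver (ofFunctor Φ₁ F₁) (ofFunctor Φ₂ F₂) Ψ)
      (e : ∀ A : C₁, Primes (Φ₁.obj (op (PreFrobenioid.baseObj F₁ A))) ≃
        Primes (Φ₂.obj (op (PreFrobenioid.baseObj F₂ (Ψ.functor.obj A))))),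
      (∀ (A : C₁) (𝔭 : Primes (Φ₁.obj (op (PreFrobenioid.baseObj F₁ A)))),
        (∀ ⦃B : C₁⦄ (φ : A ⟶ B), PreFrobenioid.IsCoAngularPreStep F₁ φ →
            (PreFrobenioid.Div F₁ φ ∈ 𝔭.submonoid ↔
              PreFrobenioid.Div F₂ (Ψ.functor.map φ) ∈ (e A 𝔭).submonoid)) ∧
        ∀ ⦃B : C₁⦄ (ψ : B ⟶ A), PreFrobenioid.IsCoAngularPreStep F₁ ψ →
          ((∃ y ∈ 𝔭.submonoid, pull Φ₁ (PreFrobenioid.Base F₁ ψ) y = PreFrobenioid.Div F₁ ψ) ↔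
            ∃ y ∈ (e A 𝔭).submonoid, pull Φ₂ (PreFrobenioid.Base F₂ (Ψ.functor.map ψ)) y =
              PreFrobenioid.Div F₂ (Ψ.functor.map ψ))) ∧
      (∀ ⦃A B : C₁⦄ (φ : A ⟶ B), PreFrobenioid.IsPreStep F₁ φ →
          E.iso A (PreFrobenioid.Div F₁ φ) = PreFrobenioid.Div F₂ (Ψ.functor.map φ)) ∧
      Literature.AlgebraicGeometry.Frobenioids.PreFrobenioidData.Thm49_compat
        (ofFunctor Φ₁ F₁) (ofFunctor Φ₂ F₂) Ψ E e :=
  exists_thm49_compat_ofFunctor_of_preservesPreSteps hF₁ hF₂ hpf₁ hpf₂ hrat₁ Ψ hT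
    (fun _ _ _ h => FrdI.isPreStep_map_of_quasiIsotropic_of_isOfFSMFFType2024 hF₁ hF₂
      hT.standard.1.quasiIsotropic hT.standard.2.quasiIsotropic hD₁ hD₂ Ψ h)
    (fun _ _ _ h => FrdI.isPreStep_map_of_quasiIsotropic_of_isOfFSMFFType2024 hF₂ hF₁
      hT.standard.2.quasiIsotropic hT.standard.1.quasiIsotropic hD₂ hD₁ Ψ.symm h)

end FrdI.T49

end Literature.AlgebraicGeometry.Frobenioids
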